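import Summits.Ventures.CertifiedManyBodySolver.Theorems.M3x2EdgeSplitSymReplayOracleCanonBox
import Summits.Ventures.CertifiedManyBodySolver.Theorems.M3x2EdgeSplitSymReplayOutRouteM
import Summits.Ventures.CertifiedManyBodySolver.Theorems.M3x2EdgeSplitSymReplayPackedHB
import HarnessLib

/-!
# SymReplay checker — HINTED OUTROUTE with a SUBSTITUTED SKELETON («H-S»), its moment-bucketed instance («H-M»), and the
PACKED module grammar («P-M»): the E-class closing chain of record in one file

(team lb-sym, cell hub-lb; hub-lb-sym-eng-4 g2.  ADDITIVE on E5 = `…OracleCanon/OracleCanonBox` (hub-lb-sym-plan-1, landed by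
hub-lb-sym-eng-3), T20b/T20c = `…OutRouteL/OutRouteM` (hub-lb-sym-eng-3) and the packed bridge `…PackedHB` (this seat); nothing
landed is touched.)

WHY.  E5's closing `energyDensity_ge_of_outrouteHBZ` takes facts on the SPEC shares `shareR K κ J i` (a leaf filter over ALL
products per module — fine at rung V, not at E-class), while T20c's `energyDensity_ge_of_outrouteM` takes facts on the
moment-BUCKETED shares `shareRFastM …` but through the UNHINTED box canon `canonNFZB`.  The E-class path of record needs both at
once — hinted canon ∘ bucketed share — and, after the E4(b) bridge, the PACKED per-module Boolean.  This file supplies exactly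
that composition; no new mathematics (E5's expansion `canonNFZH_expansion` fed to `wardD4CertGe_of_expansion` exactly as in
`wardD4CertGe_of_outrouteH`, with T20b's permutation device `polyOp_perm` for the substituted skeleton).

CONTENTS.  (a) `OutFactsHS K oracle S i n` (facts `isZero (canonNFZH K.frame oracle (S i)) = true` for an ARBITRARY share
function `S : ℕ → QPoly`), `sum_outFactsHS`, **`wardD4CertGe_of_outrouteHS`** (hypothesis `hS : ∀ i < J, (S i).Perm (shareR K κ J
i)`), `energyDensity_ge_of_outrouteHS`; (b) box / executed forms `OutFactsHSB`, `OutFactsHSBZ`, `outFactsHS_of_B`,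
`outFactsHSB_of_Z`, `energyDensity_ge_of_outrouteHSBZ`; (c) **the moment-bucketed instance** `energyDensity_ge_of_outrouteHM`
(`S i := shareRFastM Sm K (K.gramR.map genBasis) hm J i`, `hS := shareRFastM_perm`); (d) **the PACKED module grammar**:
`OutFactsP lo hi oP S i n` (facts `ppipeOKHBZ lo hi oP (S i) = true`), `outFactsHSBZ_of_packed` (by `isZero_canonNFZHBZ_of_packed`),
**`energyDensity_ge_of_outroutePM`** — CLOSING GRAMMAR OF RECORD for an E-class certificate: `gbs := K.gramR.map genBasis`,
`hcov : coverM Sm K gbs hm = true := by native_decide` (once), per module `i < J` one file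
`theorem out_i : ppipeOKHBZ lo hi oP (shareRFastM Sm K gbs hm J i) = true := by native_decide` (oP = `oracleV3` of
`…PackedOracle`, or any packed oracle), `hfacts : OutFactsP lo hi oP (fun i => shareRFastM Sm K gbs hm J i) 0 J := ⟨out_0, …,
out_{J−1}, trivial⟩`, close `energyDensity_ge_of_outroutePM Sm K hwf hRok oP hm J hJ lo hi hbox hcov hfacts`.

HONEST FRAMING: plumbing theorems composing landed soundness results; no certificate lands by this file; no bound of record moves; no
summit or crux statement is proved here; nothing here predicts superconductivity.
-/

namespace Summit.Ventures.CertifiedManyBodySolver.Theorems.SymReplay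

open Literature.MathematicalPhysics.QuantumLattice
open Literature.MathematicalPhysics.QuantumLattice.HubbardWave0
open Literature.MathematicalPhysics.QuantumLattice.ThermodynamicLimit
open Literature.Probability.LatticeModels
open Literature.MathematicalPhysics.QuantumManyBody.StateRelaxation
open Summit.Ventures.CertifiedManyBodySolver.Theorems.WardSlot

/-! ##### (a) Hinted facts on a substituted skeleton `S` -/

/-- Per-module hinted facts for an arbitrary share function `S` (frame-list form): modules `i, …, i+n−1`. -/
def OutFactsHS (K : SymCertR) (oracle : Word → HintT) (S : ℕ → QPoly) : ℕ → ℕ → Prop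
  | _, 0 => True
  | i, n + 1 => isZero (canonNFZH K.frame oracle (S i)) = true ∧ OutFactsHS K oracle S (i + 1) n

/-- Facts on `S i, …, S (i+n−1)` expand the sum of those shares into their hinted uses. -/
theorem sum_outFactsHS (K : SymCertR) (oracle : Word → HintT) (S : ℕ → QPoly) {Λ' : Finset (Site 2)}
    (hFL : K.frame.toFinset ⊆ Λ') (N : ℕ) (hQ : ∀ k, k < N → PSupp (S k) K.frame.toFinset) :
    ∀ (n i : ℕ), i + n ≤ N → OutFactsHS K oracle S i n →
      (((List.range' i n).map S).map (polyOp Λ')).sum =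
        ((((List.range' i n).map S).flatMap (canonNFZHUses K.frame oracle)).map (useOp Λ')).sum := by
  intro n
  induction n with
  | zero => intro i _ _; simp
  | succ n ih =>
    intro i hle h
    rw [List.range'_succ, List.map_cons, List.map_cons, List.sum_cons, List.flatMap_cons, List.map_append, List.sum_append,
      ih (i + 1) (by omega) h.2]
    have hexp := canonNFZH_expansion K.frame hFL oracle (S i) ((hQ i (by omega)).mono hFL)
    have hz : polyOp Λ' (canonNFZH K.frame oracle (S i)) = 0 := polyOp_eq_zero_of_isZero Λ' _ h.1
    rw [hz, zero_add] at hexp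
    rw [hexp]

/-- **HINTED OUTROUTE with a substituted skeleton is sound**: `S i ~ shareR K κ J i` for `i < J` + the `J` hinted facts on `S`
(twin of `wardD4CertGe_of_outrouteH` with T20b's permutation device). -/
theorem wardD4CertGe_of_outrouteHS (K : SymCertR) (hwf0 : wellFormed K.expand = true)
    (hRok : K.gramR.all (gramBlockROK K.frame) = true) (oracle : Word → HintT) (κ : Word → ℕ) (J : ℕ) (hJ : 0 < J)
    (S : ℕ → QPoly) (hS : ∀ i, i < J → (S i).Perm (shareR K κ J i)) (hfacts : OutFactsHS K oracle S 0 J) :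
    WardD4CertGe ((symValueR K : ℚ) : ℝ) := by
  have hwfb : wellFormed K.toSymCert = true := wellFormed_toSymCert_of_expand K hwf0
  have hRok' : ∀ B ∈ K.gramR, gramBlockROK K.frame B = true := List.all_eq_true.1 hRok
  have hsD := supp_of_gramROK K hRok
  have hQR : ∀ k, PSupp (shareR K κ J k) K.frame.toFinset := fun k => by
    rw [shareR_eq]; exact (PSupp_rawResidualR K hwfb hRok).filter _
  have hQ : ∀ k, k < J → PSupp (S k) K.frame.toFinset := fun k hk t ht => hQR k t ((hS k hk).mem_iff.mp ht)
  have hmap : ∀ Λ' : Finset (Site 2), ((List.range J).map S).map (polyOp Λ') = (sharesR K κ J).map (polyOp Λ') := by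
    intro Λ'
    rw [sharesR, List.map_map, List.map_map]
    refine List.map_congr_left fun i hi => ?_
    exact polyOp_perm Λ' (hS i (List.mem_range.mp hi))
  /- the DERIVED use family and its envelope -/
  let U := ((List.range J).map S).flatMap (canonNFZHUses K.frame oracle) ++ (K.gramR.flatMap blockUses).map negUse
  have hL : (envelope K.expand U).toList.toFinset = envelope K.expand U := Finset.toList_toFinset _
  have hFL : K.frame.toFinset ⊆ (envelope K.expand U).toList.toFinset := by
    rw [hL]; exact (subset_thicken _ 1).trans (thicken_subset_envelope K.expand U)
  have hU : ∀ e ∈ U, SuppIn e.u K.expand.frame.toFinset := by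
    intro e he
    rcases List.mem_append.1 he with he | he
    · rw [List.mem_flatMap] at he
      obtain ⟨Q, hQ', he⟩ := he
      rw [List.mem_map] at hQ'
      obtain ⟨k, hk, rfl⟩ := hQ'
      exact canonNFZHUses_supp K.frame oracle _ (hQ k (List.mem_range.mp hk)) e he
    · rw [List.mem_map] at he
      obtain ⟨e', he', rfl⟩ := he
      rw [List.mem_flatMap] at he'
      obtain ⟨B, hB, he'⟩ := he'
      rw [blockUses, List.mem_flatMap] at he'
      obtain ⟨m, -, he'⟩ := he'
      obtain ⟨t, ht, hu⟩ := polyUses_u he'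
      show SuppIn e'.u K.frame.toFinset
      rw [hu]
      exact PSupp_gramBlockPolyR B (hsD B hB).1 (hsD B hB).2 t ht
  refine wardD4CertGe_of_expansion K.expand hwf0 U hU ?_
  /- the expansion -/
  have hBL : ∀ B ∈ K.gramR, (∀ s ∈ B.reps, PSupp (genPre B.moves s) (envelope K.expand U).toList.toFinset) ∧
      ∀ q ∈ genBasis B, ∀ m ∈ B.moves,
        PSupp (movePolyF m.γ m.v q) (envelope K.expand U).toList.toFinset ∧
          isZero (psub (nfPoly (movePolyF m.γ m.v q)) (pscale m.χ q)) = true := fun B hB =>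
    ⟨fun s hs => (((gramBlockROK_spec (hRok' B hB)).1 s hs).2).mono hFL,
      fun q hq m hm => ⟨((gramBlockROK_spec (hRok' B hB)).2 q hq m hm).1.mono hFL,
        ((gramBlockROK_spec (hRok' B hB)).2 q hq m hm).2⟩⟩
  have h2 := polyOp_rhsPoly_expand (envelope K.expand U).toList.toFinset K hBL
  have hsum := sum_outFactsHS K oracle S hFL J hQ J 0 (by omega) hfacts
  rw [← List.range_eq_range'] at hsum
  change (((List.range J).map S).map _).sum =
    ((((List.range J).map S).flatMap (canonNFZHUses K.frame oracle)).map
      (useOp (envelope K.expand U).toList.toFinset)).sum at hsum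
  rw [hmap, sum_sharesR K hwfb κ hJ hFL] at hsum
  have hl : lhsPoly K.expand = lhsPoly K.toSymCert := rfl
  have hneg : (((K.gramR.flatMap blockUses).map negUse).map (useOp (envelope K.expand U).toList.toFinset)).sum =
      -((K.gramR.flatMap blockUses).map (useOp (envelope K.expand U).toList.toFinset)).sum := by
    rw [List.map_map, ← list_sum_map_neg]
    simp only [Function.comp_def, useOp_negUse]
  rw [hl, h2, List.map_append, List.sum_append, hneg, ← hsum]
  abel

/-- Closing theorem, substituted skeleton, frame-list facts. -/
theorem energyDensity_ge_of_outrouteHS (K : SymCertR) (hwf : wellFormed K.expand = true)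
    (hRok : K.gramR.all (gramBlockROK K.frame) = true) (oracle : Word → HintT) (κ : Word → ℕ) (J : ℕ) (hJ : 0 < J)
    (S : ℕ → QPoly) (hS : ∀ i, i < J → (S i).Perm (shareR K κ J i)) (hfacts : OutFactsHS K oracle S 0 J) :
    ((symValueR K : ℚ) : ℝ) ≤ energyDensityTT' 1 0 8 (7 / 8) :=
  energyDensity_ge_of_windowSound_cert _ WardSlot.stub_wardWindowSound
    (wardD4CertGe_of_outrouteHS K hwf hRok oracle κ J hJ S hS hfacts)

/-! ##### (b) Box and executed forms of the `S`-facts -/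

/-- Box hinted facts of an arbitrary share function `S` (modules `i, …, i+n−1`). -/
def OutFactsHSB (K : SymCertR) (oracle : Word → HintT) (S : ℕ → QPoly) (lo hi : ℤ × ℤ) : ℕ → ℕ → Prop
  | _, 0 => True
  | i, n + 1 => isZero (canonNFZHB lo hi oracle (S i)) = true ∧ OutFactsHSB K oracle S lo hi (i + 1) n

/-- Executed hinted facts of an arbitrary share function `S` (modules `i, …, i+n−1`). -/
def OutFactsHSBZ (K : SymCertR) (oracle : Word → HintT) (S : ℕ → QPoly) (lo hi : ℤ × ℤ) : ℕ → ℕ → Prop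
  | _, 0 => True
  | i, n + 1 => isZero (canonNFZHBZ lo hi oracle (S i)) = true ∧ OutFactsHSBZ K oracle S lo hi (i + 1) n

/-- Box `S`-facts give frame-list `S`-facts under the licence. -/
theorem outFactsHS_of_B (K : SymCertR) (oracle : Word → HintT) (S : ℕ → QPoly) {lo hi : ℤ × ℤ}
    (hb : boxLicence K.frame lo hi = true) :
    ∀ (n i : ℕ), OutFactsHSB K oracle S lo hi i n → OutFactsHS K oracle S i n := by
  intro n
  induction n with
  | zero => intro i _; exact trivial
  | succ n ih => intro i hf; exact ⟨by rw [← canonNFZHB_eq hb oracle (S i)]; exact hf.1, ih (i + 1) hf.2⟩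

/-- Executed `S`-facts give box `S`-facts. -/
theorem outFactsHSB_of_Z (K : SymCertR) (oracle : Word → HintT) (S : ℕ → QPoly) (lo hi : ℤ × ℤ) :
    ∀ (n i : ℕ), OutFactsHSBZ K oracle S lo hi i n → OutFactsHSB K oracle S lo hi i n := by
  intro n
  induction n with
  | zero => intro i _; exact trivial
  | succ n ih => intro i hf; exact ⟨by rw [← canonNFZHBZ_eq]; exact hf.1, ih (i + 1) hf.2⟩

/-- Closing theorem, substituted skeleton, executed box facts. -/
theorem energyDensity_ge_of_outrouteHSBZ (K : SymCertR) (hwf : wellFormed K.expand = true)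
    (hRok : K.gramR.all (gramBlockROK K.frame) = true) (oracle : Word → HintT) (κ : Word → ℕ) (J : ℕ) (hJ : 0 < J)
    (S : ℕ → QPoly) (hS : ∀ i, i < J → (S i).Perm (shareR K κ J i)) (lo hi : ℤ × ℤ)
    (hbox : boxLicence K.frame lo hi = true) (hfacts : OutFactsHSBZ K oracle S lo hi 0 J) :
    ((symValueR K : ℚ) : ℝ) ≤ energyDensityTT' 1 0 8 (7 / 8) :=
  energyDensity_ge_of_outrouteHS K hwf hRok oracle κ J hJ S hS
    (outFactsHS_of_B K oracle S hbox J 0 (outFactsHSB_of_Z K oracle S lo hi J 0 hfacts))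

/-! ##### (c) The moment-bucketed instance («H-M»): hinted canon ∘ `shareRFastM` -/

section Bucketed

variable {Mo : Type} [DecidableEq Mo] [Hashable Mo]

/-- **HINTED OUTROUTE with the moment-bucketed enumerator is sound.**  CLOSING GRAMMAR: `gbs := K.gramR.map genBasis`;
`hcov : coverM Sm K gbs hm = true := by native_decide` (once); per module `i < J`
`out_i : isZero (canonNFZHBZ lo hi oracle (shareRFastM Sm K gbs hm J i)) = true := by native_decide`;
`hfacts := ⟨out_0, …, out_{J−1}, trivial⟩`. -/
theorem energyDensity_ge_of_outrouteHM (Sm : MomSpec Mo) (K : SymCertR) (hwf : wellFormed K.expand = true)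
    (hRok : K.gramR.all (gramBlockROK K.frame) = true) (oracle : Word → HintT) (hm : MomTable Mo) (J : ℕ) (hJ : 0 < J)
    (lo hi : ℤ × ℤ) (hbox : boxLicence K.frame lo hi = true) (hcov : coverM Sm K (K.gramR.map genBasis) hm = true)
    (hfacts : OutFactsHSBZ K oracle (fun i => shareRFastM Sm K (K.gramR.map genBasis) hm J i) lo hi 0 J) :
    ((symValueR K : ℚ) : ℝ) ≤ energyDensityTT' 1 0 8 (7 / 8) :=
  energyDensity_ge_of_outrouteHSBZ K hwf hRok oracle (momKey Sm hm) J hJ _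
    (fun i _ => shareRFastM_perm Sm K hm J i hcov) lo hi hbox hfacts

end Bucketed

/-! ##### (d) The PACKED module grammar («P-M»): per-module Booleans on `ℕ` letter codes -/

/-- Packed per-module facts for a share function `S`: modules `i, …, i+n−1`, each `ppipeOKHBZ lo hi oP (S i) = true`. -/
def OutFactsP (lo hi : ℤ × ℤ) (oP : PackedNF.PWord → PackedNF.PHint) (S : ℕ → QPoly) : ℕ → ℕ → Prop
  | _, 0 => True
  | i, n + 1 => PackedNF.ppipeOKHBZ lo hi oP (S i) = true ∧ OutFactsP lo hi oP S (i + 1) n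

/-- Packed facts give executed hinted facts for the INDUCED oracle `oracleOfP lo hi oP` (transfer `isZero_canonNFZHBZ_of_packed`). -/
theorem outFactsHSBZ_of_packed (K : SymCertR) (lo hi : ℤ × ℤ) (oP : PackedNF.PWord → PackedNF.PHint) (S : ℕ → QPoly) :
    ∀ (n i : ℕ), OutFactsP lo hi oP S i n → OutFactsHSBZ K (PackedNF.oracleOfP lo hi oP) S lo hi i n := by
  intro n
  induction n with
  | zero => intro i _; exact trivial
  | succ n ih => intro i hf; exact ⟨PackedNF.isZero_canonNFZHBZ_of_packed lo hi oP (S i) hf.1, ih (i + 1) hf.2⟩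

/-- **Closing theorem, substituted skeleton, PACKED facts.** -/
theorem energyDensity_ge_of_outroutePS (K : SymCertR) (hwf : wellFormed K.expand = true)
    (hRok : K.gramR.all (gramBlockROK K.frame) = true) (oP : PackedNF.PWord → PackedNF.PHint) (κ : Word → ℕ) (J : ℕ)
    (hJ : 0 < J) (S : ℕ → QPoly) (hS : ∀ i, i < J → (S i).Perm (shareR K κ J i)) (lo hi : ℤ × ℤ)
    (hbox : boxLicence K.frame lo hi = true) (hfacts : OutFactsP lo hi oP S 0 J) :
    ((symValueR K : ℚ) : ℝ) ≤ energyDensityTT' 1 0 8 (7 / 8) :=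
  energyDensity_ge_of_outrouteHSBZ K hwf hRok (PackedNF.oracleOfP lo hi oP) κ J hJ S hS lo hi hbox
    (outFactsHSBZ_of_packed K lo hi oP S J 0 hfacts)

section PackedBucketed

variable {Mo : Type} [DecidableEq Mo] [Hashable Mo]

/-- **THE E-CLASS CLOSING OF RECORD (packed pipe ∘ hinted canon ∘ moment-bucketed shares).**  CLOSING GRAMMAR:
`gbs := K.gramR.map genBasis`; `hcov : coverM Sm K gbs hm = true := by native_decide` (once); per module `i < J` one file
`theorem out_i : PackedNF.ppipeOKHBZ lo hi oP (shareRFastM Sm K gbs hm J i) = true := by native_decide`;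
`hfacts : OutFactsP lo hi oP (fun i => shareRFastM Sm K gbs hm J i) 0 J := ⟨out_0, …, out_{J−1}, trivial⟩`. -/
theorem energyDensity_ge_of_outroutePM (Sm : MomSpec Mo) (K : SymCertR) (hwf : wellFormed K.expand = true)
    (hRok : K.gramR.all (gramBlockROK K.frame) = true) (oP : PackedNF.PWord → PackedNF.PHint) (hm : MomTable Mo) (J : ℕ)
    (hJ : 0 < J) (lo hi : ℤ × ℤ) (hbox : boxLicence K.frame lo hi = true) (hcov : coverM Sm K (K.gramR.map genBasis) hm = true)
    (hfacts : OutFactsP lo hi oP (fun i => shareRFastM Sm K (K.gramR.map genBasis) hm J i) 0 J) :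
    ((symValueR K : ℚ) : ℝ) ≤ energyDensityTT' 1 0 8 (7 / 8) :=
  energyDensity_ge_of_outroutePS K hwf hRok oP (momKey Sm hm) J hJ _ (fun i _ => shareRFastM_perm Sm K hm J i hcov)
    lo hi hbox hfacts

end PackedBucketed

/-- **Packed spec-share closing** (`S i := shareR K κ J i`, any `κ`; the rung-V-size path: `out_i : ppipeOKHBZ lo hi oP
(shareR K κ J i) = true := by native_decide`). -/
theorem energyDensity_ge_of_outrouteP (K : SymCertR) (hwf : wellFormed K.expand = true)
    (hRok : K.gramR.all (gramBlockROK K.frame) = true) (oP : PackedNF.PWord → PackedNF.PHint) (κ : Word → ℕ) (J : ℕ)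
    (hJ : 0 < J) (lo hi : ℤ × ℤ) (hbox : boxLicence K.frame lo hi = true)
    (hfacts : OutFactsP lo hi oP (shareR K κ J) 0 J) : ((symValueR K : ℚ) : ℝ) ≤ energyDensityTT' 1 0 8 (7 / 8) :=
  energyDensity_ge_of_outroutePS K hwf hRok oP κ J hJ _ (fun _ _ => List.Perm.refl _) lo hi hbox hfacts

end Summit.Ventures.CertifiedManyBodySolver.Theorems.SymReplay
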